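import Summits.NavierStokesRegularity.FluidComputer.GateBudgetSwingPrice
import HarnessLib

/-!
# GateBudget part 124 — the θ-priced rung, I: the pulse ceiling at `k = 1` under the clock
# floor `θ ≥ 273/200` (§327)

Cell `pub-fluidc`, blueprint seat bp1 (gen 42; SPEC-INPUT-bp1 §CR(3)(b), §CS);
namespace `Summit.NavierStokesRegularity.FluidComputer.GateBudget`, headline family
`RotorKnob.rotorCircuit K K¹⁰ ε ρ` from `delayInit` (`K ≥ 16`) on the UNIT lattice
`ε = K¹⁰ρ²`. HONEST FRAMING: a low prior, high value-of-information experiment on Tao's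
machine paradigm; NOT a claim that NS blows up. Nothing here is about the Navier–Stokes
equations: these are inequalities about the five-mode toy circuit (5.5)/(5.6).

* §327a `pulse_drift_numerics`, `pulse_fall_tiny_numerics` — the drift terms (B3)/(B9) and the
  two tiny fall terms (B7)/(B8) of part 105's proof as stand-alone numerics (`K ≥ 16`),
  extracted so that §327 elaborates within the default heartbeat budget.
* §327 `knob_pulse_ceiling_swing_sharp` — part 105 §287 `knob_pulse_ceiling_swing` RE-RUN with
  the ignition clock floor `273/200 ≤ θ` in place of `5/4 ≤ θ` (the ladder's true floor: part
  93's capped-square clock invariant gives `θ ≥ 1.365` at every rung, part 125 §328d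
  `ladder_clock_floor_sharp`), every other hypothesis VERBATIM:
  `ã(T') - ã(r) ≤ (1.437·a(r)² + 3.05·(|d(r)| + d(r)²) + 0.223 + (511d(r)² + 1500δ²)log K)/K⁹`
  against part 105's `(1.57a(r)² + 3.33(…) + 1/4 + (520d(r)² + 1500δ²)log K)/K⁹`. The proof is
  part 105's, with `θ⁻¹ ≤ 200/273` in place of `θ⁻¹ ≤ 4/5` in its five uses: the climb `k²`-term
  `0.056 → 0.0504`, the fall `k²`-term `0.183 → 0.1668`, the climb pair term `32 → 29`
  (`d(r)² log K`), the swing factor `(1 + 2/10⁴)/θ ≤ 0.80016 → 0.73275` (so `1.96 → 1.437a(r)²`,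
  `4.16 → 3.05(|d| + d²)`), constants `0.2445 → 0.2227 ≤ 0.223`.

WHAT THIS SAYS (and does not). The per-rung transfer price at `k = 1` drops from part 106's
`U ≥ 1.57 + 1/3 + … ≈ 1.91` (filed as `U ≥ 2`) to `U′ ≈ 1.437 + 0.223 + 10⁻⁶ + O(D) ≈ 1.66`;
parts 125–128 re-run the rung, the step (over part 117's UNCHANGED invariant `SwingRung` with
the slip parameter rescaled `δ′ = 2δ/(1 + γ)`, `γ = U′ - 1`), the clean run and the headline:
the certified floor of the clean dud horizon moves from `0.065K⁹` (part 118) to `0.076K⁹`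
(part 128) clean misfires, against the unchanged ceiling `0.1132K⁹ + 1` (part 119). HONEST
LIMITS: (i) `k = 1` only; (ii) `a(r) ≠ 0` is a hypothesis; (iii) the constants `0.223`, `511`
carry part 75's slack; (iv) no matching phase-resolved floor; (v) nothing about NS.
[cite: Tao2016AveragedNS, §5.5 Theorem 5.3, (5.5), (b-eq), (c-eq), (d-eq), (energy-con)]
-/

noncomputable section

namespace Summit.NavierStokesRegularity.FluidComputer.GateBudget

open Real Set Filter Topology
open Literature.Analysis.FluidPDE.Tao2016AveragedNS

variable {K M ε ρ : ℝ} {X : ℝ → Fin 5 → ℝ} {C : ℝ → ℝ}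

/-! ## §327a Numerics of the drift and of the tiny fall terms -/

/-- §327a (numerics, `K ≥ 16`): for `L ≤ (9/8)K` and a duration `0 ≤ τ ≤ 242/K⁹`, the drift
`6KLτ² ≤ 0.0015/K⁹` and `6Lτ ≤ 10⁻⁴` (part 105's (B3)/(B9) and the swing's `6L(T' - r)`). -/
theorem pulse_drift_numerics {L τ : ℝ} (hK : 16 ≤ K) (hL98 : L ≤ 9 / 8 * K) (hτ0 : 0 ≤ τ)
    (hτ : τ ≤ 242 / K ^ 9) :
    6 * K * L * τ * τ ≤ 0.0015 / K ^ 9 ∧ 6 * L * τ ≤ 1 / 10 ^ 4 := by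
  have hK0 : (0 : ℝ) < K := by linarith
  refine ⟨?_, ?_⟩
  · have e1 : 6 * K * L * τ * τ ≤ 6 * K * (9 / 8 * K) * (242 / K ^ 9) * (242 / K ^ 9) := by
      have := mul_le_mul hτ hτ hτ0 (by positivity)
      have := mul_le_mul hL98 this (by positivity) (by positivity)
      nlinarith only [this, hK0]
    refine e1.trans ?_
    rw [show 6 * K * (9 / 8 * K) * (242 / K ^ 9) * (242 / K ^ 9)
        = 395307 * K ^ 2 / (K ^ 9 * K ^ 9) by field_simp; ring,
      div_le_div_iff₀ (by positivity) (by positivity)]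
    have h7 : (16 : ℝ) ^ 7 ≤ K ^ 7 := pow_le_pow_left₀ (by norm_num) hK 7
    nlinarith only [h7, pow_pos hK0 11]
  · have e1 : 6 * L * τ ≤ 6 * (9 / 8 * K) * (242 / K ^ 9) :=
      mul_le_mul (mul_le_mul_of_nonneg_left hL98 (by norm_num)) hτ hτ0 (by positivity)
    refine e1.trans ?_
    rw [show 6 * (9 / 8 * K) * (242 / K ^ 9) = 3267 / 2 * K / K ^ 9 by field_simp; ring,
      div_le_iff₀ (by positivity)]
    have h8 : (16 : ℝ) ^ 8 ≤ K ^ 8 := pow_le_pow_left₀ (by norm_num) hK 8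
    have h9 : K * 16 ^ 8 ≤ K * K ^ 8 := mul_le_mul_of_nonneg_left h8 hK0.le
    have h10 : K * K ^ 8 = K ^ 9 := by ring
    nlinarith only [h9, h10, hK0]

/-- §327a (numerics, `K ≥ 16`, `0 < ε`, `θ ≥ 1`, `ρ² = ε/K¹⁰`): for `σ ≤ ρ²`,
`0 ≤ ξ ≤ 1/K¹⁰` and `0 ≤ τ ≤ 242/K⁹`, the two tiny fall terms of part 105 (B7)/(B8):
`6Kξ²τ ≤ 0.001/K⁹` and `12κ₂σετ ≤ 0.001/K⁹` with `κ₂ = Kε/(K¹⁰((15/16)θε)³)`. -/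
theorem pulse_fall_tiny_numerics {θ σ ξ τ : ℝ} (hK : 16 ≤ K) (hε : 0 < ε) (hθ : 1 ≤ θ)
    (hρk : ρ ^ 2 = ε / K ^ 10) (hσρ : σ ≤ ρ ^ 2) (hξ0 : 0 ≤ ξ) (hξ1 : ξ ≤ 1 / K ^ 10)
    (hτ0 : 0 ≤ τ) (hτ : τ ≤ 242 / K ^ 9) :
    6 * K * ξ ^ 2 * τ ≤ 0.001 / K ^ 9 ∧
      12 * (K * ε / (K ^ 10 * (15 / 16 * θ * ε) ^ 3)) * σ * ε * τ ≤ 0.001 / K ^ 9 := by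
  have hK0 : (0 : ℝ) < K := by linarith
  have hK10 : (16 : ℝ) ^ 10 ≤ K ^ 10 := pow_le_pow_left₀ (by norm_num) hK 10
  have hθ0 : 0 < θ := by linarith
  refine ⟨?_, ?_⟩
  · have e1 : ξ ^ 2 ≤ (1 / K ^ 10) ^ 2 := pow_le_pow_left₀ hξ0 hξ1 2
    have e2 : 6 * K * ξ ^ 2 * τ ≤ 6 * K * (1 / K ^ 10) ^ 2 * (242 / K ^ 9) := by
      have := mul_le_mul e1 hτ hτ0 (by positivity)
      nlinarith only [this, hK0]
    refine e2.trans ?_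
    rw [show 6 * K * (1 / K ^ 10) ^ 2 * (242 / K ^ 9) = 1452 * K / (K ^ 20 * K ^ 9) by
        field_simp; ring, div_le_div_iff₀ (by positivity) (by positivity)]
    have h19 : (16 : ℝ) ^ 19 ≤ K ^ 19 := pow_le_pow_left₀ (by norm_num) hK 19
    nlinarith only [h19, pow_pos hK0 10]
  · obtain ⟨κ₂, hκ₂⟩ : ∃ κ₂ : ℝ, κ₂ = K * ε / (K ^ 10 * (15 / 16 * θ * ε) ^ 3) := ⟨_, rfl⟩
    rw [← hκ₂]
    have hκ₂0 : 0 ≤ κ₂ := by rw [hκ₂]; positivity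
    have e1 : κ₂ * ρ ^ 2 * ε = 4096 / 3375 * (θ ^ 3)⁻¹ * (K / K ^ 20) := by
      rw [hκ₂, hρk]; field_simp; ring
    have hθ3 : (θ ^ 3)⁻¹ ≤ 1 := inv_le_one_of_one_le₀ (one_le_pow₀ hθ)
    have e2 : K / K ^ 20 ≤ 1 / (200 * K ^ 9) := by
      rw [div_le_div_iff₀ (by positivity) (by positivity)]
      nlinarith only [hK10, pow_pos hK0 10, hK0]
    have e3 : κ₂ * ρ ^ 2 * ε ≤ 4096 / 3375 * 1 * (1 / (200 * K ^ 9)) := by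
      rw [e1]; exact mul_le_mul (mul_le_mul_of_nonneg_left hθ3 (by norm_num)) e2
        (by positivity) (by positivity)
    have e4 : 12 * κ₂ * σ * ε * τ ≤ 12 * (κ₂ * ρ ^ 2 * ε) * (242 / K ^ 9) := by
      have := mul_le_mul (mul_le_mul_of_nonneg_left hσρ hκ₂0) hτ hτ0 (by positivity)
      nlinarith only [this, hε.le]
    refine e4.trans ?_
    have e5 : 12 * (κ₂ * ρ ^ 2 * ε) * (242 / K ^ 9)
        ≤ 12 * (4096 / 3375 * 1 * (1 / (200 * K ^ 9))) * (242 / K ^ 9) :=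
      mul_le_mul_of_nonneg_right (mul_le_mul_of_nonneg_left e3 (by norm_num)) (by positivity)
    refine e5.trans ?_
    rw [show 12 * (4096 / 3375 * 1 * (1 / (200 * (K : ℝ) ^ 9))) * (242 / K ^ 9)
        = 12 * 4096 * 242 / (3375 * 200) / (K ^ 9 * K ^ 9) by field_simp,
      div_le_div_iff₀ (by positivity) (by positivity)]
    have h9 : (16 : ℝ) ^ 9 ≤ K ^ 9 := pow_le_pow_left₀ (by norm_num) hK 9
    nlinarith only [h9, pow_pos hK0 9]

/-! ## §327 The pulse ceiling with the swing price under the clock floor `θ ≥ 273/200` -/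

/-- §327 THE PULSE CEILING WITH THE SWING PRICE UNDER THE CLOCK FLOOR (headline member,
`K ≥ 16`, unit lattice `ε = K¹⁰ρ²`). For a pulse on `[r, T']` (`r ≥ 0`) igniting at
`b(r) = θε`, `273/200 ≤ θ ≤ 3/2`,
`c(r) = ρ²/K⁹`, `a(r) ≠ 0`, staying in the kept ring with `c > 0`, of duration
`T' - r ≤ 242/K⁹` and `≤ 241 log K/K¹⁰`, ending with `b(T') ≤ -(31/32)θε` and exit phase
`|Φ(T') - π| ≤ δ`:
`ã(T') - ã(r) ≤ (1.437a(r)² + 3.05(|d(r)| + d(r)²) + 0.223 + (511d(r)² + 1500δ²)log K)/K⁹`.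
[derived: part 105 §287 (re-run), part 100 §277, part 74 §224/§225, part 104 §286] -/
theorem knob_pulse_ceiling_swing_sharp
    (hX : ∀ t, HasDerivAt X (RotorKnob.rotorCircuit K (K ^ 10) ε ρ (X t)) t)
    (h0 : X 0 = delayInit) (hC : ∀ t, HasDerivAt C (X t 2) t) (hK : 16 ≤ K) (hε : 0 < ε)
    (hρ : 0 < ρ) (hlat : ε = K ^ 10 * ρ ^ 2) {r T' θ δ : ℝ} (hr : 0 ≤ r) (hrT : r ≤ T')
    (hτ : T' - r ≤ 242 / K ^ 9) (hτ' : T' - r ≤ 241 * log K / K ^ 10) (hθ1 : 273 / 200 ≤ θ)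
    (hθ2 : θ ≤ 3 / 2) (ha : X r 0 ≠ 0) (hbr : X r 1 = θ * ε) (hcr : X r 2 = ρ ^ 2 / K ^ 9)
    (hkept : ∀ t ∈ Icc r T', |X t 1 ^ 2 + X t 2 ^ 2 - (X r 1 ^ 2 + X r 2 ^ 2)| ≤ ε ^ 2 / 10 ^ 6)
    (hpos : ∀ t ∈ Icc r T', 0 < X t 2) (hbT : X T' 1 ≤ -(31 / 32 * θ * ε))
    (hpin : |(C T' - C r) / ρ ^ 2 - π| ≤ δ) :
    X T' 4 - X r 4 ≤ (1437 / 1000 * X r 0 ^ 2 + 305 / 100 * (|X r 3| + X r 3 ^ 2) + 223 / 1000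
      + (511 * X r 3 ^ 2 + 1500 * δ ^ 2) * log K) / K ^ 9 := by
  have hθ54 : 5 / 4 ≤ θ := by linarith only [hθ1]
  have hK0 : (0 : ℝ) < K := by linarith
  have hK1 : (1 : ℝ) ≤ K := by linarith
  have hk : ε = ((1 : ℕ) : ℝ) * K ^ 10 * ρ ^ 2 := by rw [hlat]; push_cast; ring
  have hKρ0 : 0 ≤ K ^ 10 * ρ ^ 2 := by positivity
  have hhi : K ^ 10 * ρ ^ 2 ≤ 2 * ε := by rw [hlat]; linarith only [hKρ0]
  have hlogK : 0 ≤ log K := log_nonneg hK1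
  have hθ0 : 0 < θ := by linarith
  have hθi : θ⁻¹ ≤ 200 / 273 := by rw [inv_le_comm₀ hθ0 (by norm_num)]; linarith only [hθ1]
  have hτ0 : 0 ≤ T' - r := by linarith
  have hε1 : ε ≤ 4 / 5 := by
    have hb1 := (abs_le.1 (RotorKnob.traj_abs_le_one hX h0 r 1)).2
    rw [hbr] at hb1
    nlinarith only [hb1, hθ1, hε]
  have hρε : ρ ^ 2 ≤ ε := by
    rw [hlat]; nlinarith only [one_le_pow₀ hK1 (n := 10), sq_nonneg ρ]
  have hρk : ρ ^ 2 = ε / K ^ 10 := by rw [hlat]; field_simp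
  have hexp1 : exp (-K ^ 10) ≤ 1 := exp_le_one_iff.2 (by simp [pow_nonneg hK0.le])
  -- the band times (part 100 §277)
  obtain ⟨t₁, t₂, hrt₁, ht₁₂, ht₂T, hb1, hb2, hcl, hband, hbfall, hring, hc1, hc2, hclimb,
    hdlo, hdhi⟩ := pulse_swing_band hX h0 hC hK hε hρ hhi hrT hτ hθ54 hbr hcr hkept hpos hbT
  have hrt₂ : r ≤ t₂ := hrt₁.le.trans ht₁₂.le
  have ht₁T : t₁ ≤ T' := ht₁₂.le.trans ht₂T
  -- (1) the climb law (part 74 §224), (2) the swing price (part 104 §286), (3) the fall law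
  have hΔ1 := leak_climb hX h0 hC hK0.le hε 1 hk hr hrt₁.le ht₁T
    (by positivity : (0 : ℝ) < 31 / 32 * θ * ε) (fun u hu => (hcl u hu).1)
  have hΔ2 := swing_headline_price hX h0 hC hK hε hlat hr hrt₁.le ht₁₂.le ht₂T hτ hθ54 ha hcr
    hring hpos hb1 hb2 hband hdlo hdhi rfl
  have hc2ε : ∀ u ∈ Icc t₂ T', X u 2 ≤ 2 * ε := by
    intro u hu
    have huI : u ∈ Icc r T' := ⟨hrt₂.trans hu.1, hu.2⟩
    have hringu := (abs_le.1 (hkept u huI)).2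
    rw [hbr, hcr] at hringu
    have h1 : (ρ ^ 2 / K ^ 9) ^ 2 ≤ ε ^ 2 :=
      pow_le_pow_left₀ (by positivity)
        ((div_le_self (sq_nonneg ρ) (one_le_pow₀ hK1)).trans hρε) 2
    have h2 : (θ * ε) ^ 2 ≤ (3 / 2 * ε) ^ 2 :=
      pow_le_pow_left₀ (by positivity) (by nlinarith only [hθ2, hε]) 2
    have h3 : X u 2 ^ 2 ≤ (2 * ε) ^ 2 := by
      nlinarith only [hringu, h1, h2, sq_nonneg (X u 1), hε]
    exact (abs_le_of_sq_le_sq' h3 (by positivity)).2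
  have hpin' : |(C T' - C r) / ρ ^ 2 - ((1 : ℕ) : ℝ) * π| ≤ δ := by simpa using hpin
  have hΔ3 := leak_fall hX h0 hC hK0.le hε 1 hk hr hrt₂ ht₂T
    (by positivity : (0 : ℝ) < 15 / 16 * θ * ε) hbfall hc2ε hpin'
  simp only [Nat.cast_one, one_pow, mul_one, one_mul] at hΔ1 hΔ3
  -- names
  obtain ⟨L, hL⟩ : ∃ L : ℝ, L = ε + ρ ^ 2 * exp (-K ^ 10) + K * X T' 4 := ⟨_, rfl⟩
  obtain ⟨κ₁, hκ₁⟩ : ∃ κ₁ : ℝ, κ₁ = K * ε / (K ^ 10 * (31 / 32 * θ * ε) ^ 3) := ⟨_, rfl⟩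
  obtain ⟨κ₂, hκ₂⟩ : ∃ κ₂ : ℝ, κ₂ = K * ε / (K ^ 10 * (15 / 16 * θ * ε) ^ 3) := ⟨_, rfl⟩
  obtain ⟨σ, hσ⟩ : ∃ σ : ℝ, σ = ρ ^ 2 * exp (-K ^ 10) := ⟨_, rfl⟩
  obtain ⟨ξ, hξ⟩ : ∃ ξ : ℝ, ξ = σ * (T' - r) / (15 / 16 * θ * ε) := ⟨_, rfl⟩
  obtain ⟨W, hW⟩ : ∃ W : ℝ, W = |X r 3| + X r 3 ^ 2 := ⟨_, rfl⟩
  rw [← hL, ← hκ₁] at hΔ1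
  rw [← hL] at hΔ2
  rw [← hL, ← hκ₂, ← hσ, ← hξ] at hΔ3
  have hσ0 : 0 ≤ σ := by rw [hσ]; positivity
  have hσρ : σ ≤ ρ ^ 2 := by
    rw [hσ]; exact (mul_le_mul_of_nonneg_left hexp1 (sq_nonneg ρ)).trans (mul_one _).le
  have hκ₁0 : 0 ≤ κ₁ := by rw [hκ₁]; positivity
  have hκ₂0 : 0 ≤ κ₂ := by rw [hκ₂]; positivity
  have hd0 := sq_nonneg (X r 3)
  have hW0 : 0 ≤ W := by rw [hW]; positivity
  -- (B1) climb k²-term, (B5) fall k²-term (k = 1)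
  have hB1 : κ₁ * (X t₁ 2 ^ 2 - X r 2 ^ 2) ≤ 0.0504 / K ^ 9 := by
    have e1 : κ₁ * (X t₁ 2 ^ 2 - X r 2 ^ 2) ≤ κ₁ * (θ ^ 2 * ε ^ 2 / 16) :=
      mul_le_mul_of_nonneg_left (by nlinarith only [hc1, sq_nonneg (X r 2)]) hκ₁0
    have e2 : κ₁ * (θ ^ 2 * ε ^ 2 / 16) = 2048 / 29791 * θ⁻¹ / K ^ 9 := by
      rw [hκ₁]; field_simp; ring
    have e3 : 2048 / 29791 * θ⁻¹ / K ^ 9 ≤ 0.0504 / K ^ 9 :=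
      div_le_div_of_nonneg_right (by nlinarith only [hθi]) (by positivity)
    linarith only [e1, e2.le, e3]
  have hB5 : 3 * κ₂ * X t₂ 2 ^ 2 ≤ 0.1668 / K ^ 9 := by
    have e1 : 3 * κ₂ * X t₂ 2 ^ 2 ≤ 3 * κ₂ * (θ ^ 2 * ε ^ 2 / 16) :=
      mul_le_mul_of_nonneg_left hc2 (by positivity)
    have e2 : 3 * κ₂ * (θ ^ 2 * ε ^ 2 / 16) = 768 / 3375 * θ⁻¹ / K ^ 9 := by
      rw [hκ₂]; field_simp; ring
    have e3 : 768 / 3375 * θ⁻¹ / K ^ 9 ≤ 0.1668 / K ^ 9 :=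
      div_le_div_of_nonneg_right (by nlinarith only [hθi]) (by positivity)
    linarith only [e1, e2.le, e3]
  -- (B2) the pair term of the climb: `2Kd(r)²(t₁ - r) ≤ 29 d(r)² log K/K⁹`
  have hc1pos : 0 < X t₁ 2 := hpos t₁ ⟨hrt₁.le, ht₁T⟩
  have hcrpos : 0 < X r 2 := hpos r ⟨le_rfl, hrT⟩
  have hlog : log (X t₁ 2) - log (X r 2) ≤ 19 * log K := by
    have hc1le : X t₁ 2 ≤ ε := by
      have h := (abs_le_of_sq_le_sq' (by nlinarith only [hc1] : X t₁ 2 ^ 2 ≤ (θ * ε / 4) ^ 2)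
        (by positivity)).2
      nlinarith only [h, hθ2, hε]
    have hratio : X t₁ 2 / X r 2 ≤ K ^ 19 := by
      rw [div_le_iff₀ hcrpos, hcr]
      have e : K ^ 19 * (ρ ^ 2 / K ^ 9) = ε := by rw [hlat]; field_simp
      rw [e]; exact hc1le
    rw [← log_div hc1pos.ne' hcrpos.ne']
    calc log (X t₁ 2 / X r 2) ≤ log (K ^ 19) := log_le_log (by positivity) hratio
      _ = 19 * log K := by rw [log_pow]; push_cast; ring
  have hB2 : 2 * K * X r 3 ^ 2 * (t₁ - r) ≤ 29 * X r 3 ^ 2 * log K / K ^ 9 := by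
    have e1 : t₁ - r ≤ 32 * (19 * log K) / (31 * θ * K ^ 10) :=
      hclimb.trans (div_le_div_of_nonneg_right (by linarith only [hlog]) (by positivity))
    have e2 := mul_le_mul_of_nonneg_left e1 (by positivity : (0 : ℝ) ≤ 2 * K * X r 3 ^ 2)
    have e3 : 2 * K * X r 3 ^ 2 * (32 * (19 * log K) / (31 * θ * K ^ 10))
        = 1216 / 31 * θ⁻¹ * (X r 3 ^ 2 * log K / K ^ 9) := by
      field_simp; ring
    have e4 : 1216 / 31 * θ⁻¹ * (X r 3 ^ 2 * log K / K ^ 9)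
        ≤ 29 * (X r 3 ^ 2 * log K / K ^ 9) :=
      mul_le_mul_of_nonneg_right (by nlinarith only [hθi]) (by positivity)
    have e5 : 29 * (X r 3 ^ 2 * log K / K ^ 9) = 29 * X r 3 ^ 2 * log K / K ^ 9 := by ring
    linarith only [e2, e3.le, e4, e5.le]
  -- (B3/B9) the drift `6KL(T' - r)² ≤ 0.0015/K⁹`
  have hL98 : L ≤ 9 / 8 * K := by
    have hae := (abs_le.1 (RotorKnob.traj_abs_le_one hX h0 T' 4)).2
    rw [hL, ← hσ]
    nlinarith only [hae, hε1, hσρ, hρε, hK, hK0]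
  have hL0 : 0 ≤ L := by
    rw [hL]; have := RotorKnob.e_nonneg hX h0 hK0.le (hr.trans hrT); positivity
  obtain ⟨hdrift, hG⟩ := pulse_drift_numerics hK hL98 hτ0 hτ
  have hB3 : 6 * K * L * (T' - r) * (t₁ - r) ≤ 0.0015 / K ^ 9 :=
    (mul_le_mul_of_nonneg_left (by linarith only [ht₁T]) (by positivity)).trans hdrift
  -- (B4) THE SWING PRICE: `≤ (1.437a(r)² + 3.05W + 0.0005)/K⁹` (part 104 §286)
  have ha2 : 0 < X r 0 ^ 2 := lt_of_le_of_ne (sq_nonneg _) (Ne.symm (pow_ne_zero 2 ha))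
  have hB4 : (1 + 2 / 10 ^ 4) * X r 0 ^ 2 / (θ * K ^ 9)
        * (196 / 100 + 416 / 100 * ((|X r 3| + X r 3 ^ 2 + 6 * L * (T' - r)) / X r 0 ^ 2))
      ≤ (1437 / 1000 * X r 0 ^ 2 + 305 / 100 * W + 0.0005) / K ^ 9 := by
    rw [← hW]
    have e1 : (1 + 2 / 10 ^ 4) * X r 0 ^ 2 / (θ * K ^ 9)
          * (196 / 100 + 416 / 100 * ((W + 6 * L * (T' - r)) / X r 0 ^ 2))
        = (1 + 2 / 10 ^ 4) * θ⁻¹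
          * (196 / 100 * X r 0 ^ 2 + 416 / 100 * W + 416 / 100 * (6 * L * (T' - r)))
          / K ^ 9 := by
      field_simp
      ring
    rw [e1]
    refine div_le_div_of_nonneg_right ?_ (by positivity)
    have hφ : (1 + 2 / 10 ^ 4) * θ⁻¹ ≤ 73275 / 100000 := by nlinarith only [hθi]
    have hS0 : 0 ≤ 196 / 100 * X r 0 ^ 2 + 416 / 100 * W + 416 / 100 * (6 * L * (T' - r)) := by
      positivity
    have e2 := mul_le_mul_of_nonneg_right hφ hS0
    nlinarith only [e2, hG, ha2, hW0]
  -- (B6) pair and pin terms of the fall, (B7) `6Kξ²τ`, (B8) `12κ₂σετ` tiny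
  have hB6 : K * (2 * X r 3 ^ 2 + 6 * δ ^ 2) * (T' - r)
      ≤ (482 * X r 3 ^ 2 + 1446 * δ ^ 2) * log K / K ^ 9 := by
    have e1 := mul_le_mul_of_nonneg_left hτ'
      (by positivity : (0 : ℝ) ≤ K * (2 * X r 3 ^ 2 + 6 * δ ^ 2))
    have e2 : K * (2 * X r 3 ^ 2 + 6 * δ ^ 2) * (241 * log K / K ^ 10)
        = (482 * X r 3 ^ 2 + 1446 * δ ^ 2) * log K / K ^ 9 := by field_simp; ring
    linarith only [e1, e2.le]
  have hξ1 : ξ ≤ 1 / K ^ 10 := by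
    rw [hξ, div_le_div_iff₀ (by positivity) (by positivity), one_mul]
    have e1 : σ * (T' - r) ≤ ρ ^ 2 * (T' - r) := mul_le_mul_of_nonneg_right hσρ hτ0
    have e3 : T' - r ≤ 1 := by
      refine hτ.trans ?_
      rw [div_le_one (by positivity)]
      nlinarith only [pow_le_pow_left₀ (by norm_num : (0 : ℝ) ≤ 16) hK 9]
    have e4 : ε / K ^ 10 * (T' - r) * K ^ 10 ≤ 15 / 16 * θ * ε := by
      rw [div_mul_eq_mul_div, div_mul_cancel₀ _ (by positivity)]
      nlinarith only [e3, hθ1, hε, hτ0]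
    calc σ * (T' - r) * K ^ 10 ≤ ρ ^ 2 * (T' - r) * K ^ 10 :=
          mul_le_mul_of_nonneg_right e1 (by positivity)
      _ = ε / K ^ 10 * (T' - r) * K ^ 10 := by rw [hρk]
      _ ≤ 15 / 16 * θ * ε := e4
  have hξ0 : 0 ≤ ξ := by rw [hξ]; positivity
  have hB78 := pulse_fall_tiny_numerics hK hε (by linarith only [hθ1]) hρk hσρ hξ0 hξ1 hτ0 hτ
  rw [← hκ₂] at hB78
  obtain ⟨hB7, hB8⟩ := hB78
  -- the fall bracket at `T' - t₂ ≤ T' - r`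
  have hfall : (K * (2 * X r 3 ^ 2 + 6 * δ ^ 2 + 6 * ξ ^ 2) + 12 * κ₂ * σ * ε
        + 6 * K * L * (T' - r)) * (T' - t₂)
      ≤ (482 * X r 3 ^ 2 + 1446 * δ ^ 2) * log K / K ^ 9 + 0.001 / K ^ 9 + 0.001 / K ^ 9
        + 0.0015 / K ^ 9 := by
    have e1 : (K * (2 * X r 3 ^ 2 + 6 * δ ^ 2 + 6 * ξ ^ 2) + 12 * κ₂ * σ * ε
          + 6 * K * L * (T' - r)) * (T' - t₂)
        ≤ (K * (2 * X r 3 ^ 2 + 6 * δ ^ 2 + 6 * ξ ^ 2) + 12 * κ₂ * σ * ε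
          + 6 * K * L * (T' - r)) * (T' - r) :=
      mul_le_mul_of_nonneg_left (by linarith only [hrt₂]) (by positivity)
    have e2 : (K * (2 * X r 3 ^ 2 + 6 * δ ^ 2 + 6 * ξ ^ 2) + 12 * κ₂ * σ * ε
          + 6 * K * L * (T' - r)) * (T' - r)
        = K * (2 * X r 3 ^ 2 + 6 * δ ^ 2) * (T' - r) + 6 * K * ξ ^ 2 * (T' - r)
          + 12 * κ₂ * σ * ε * (T' - r) + 6 * K * L * (T' - r) * (T' - r) := by ring
    linarith only [e1, e2.le, hB6, hB7, hB8, hdrift]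
  -- the sum
  have hK9 : (0 : ℝ) < K ^ 9 := by positivity
  have hsum : X T' 4 - X r 4 ≤ (0.0504 + 29 * X r 3 ^ 2 * log K + 0.0015
      + (1437 / 1000 * X r 0 ^ 2 + 305 / 100 * W + 0.0005) + 0.1668
      + (482 * X r 3 ^ 2 + 1446 * δ ^ 2) * log K + 0.001 + 0.001 + 0.0015) / K ^ 9 := by
    have e : (0.0504 + 29 * X r 3 ^ 2 * log K + 0.0015
        + (1437 / 1000 * X r 0 ^ 2 + 305 / 100 * W + 0.0005) + 0.1668
        + (482 * X r 3 ^ 2 + 1446 * δ ^ 2) * log K + 0.001 + 0.001 + 0.0015) / K ^ 9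
        = 0.0504 / K ^ 9 + 29 * X r 3 ^ 2 * log K / K ^ 9 + 0.0015 / K ^ 9
          + (1437 / 1000 * X r 0 ^ 2 + 305 / 100 * W + 0.0005) / K ^ 9 + 0.1668 / K ^ 9
          + ((482 * X r 3 ^ 2 + 1446 * δ ^ 2) * log K / K ^ 9 + 0.001 / K ^ 9
            + 0.001 / K ^ 9 + 0.0015 / K ^ 9) := by
      field_simp
      ring
    rw [e]
    linarith only [hΔ1, hΔ2, hΔ3, hB1, hB2, hB3, hB4, hB5, hfall]
  refine hsum.trans (div_le_div_of_nonneg_right ?_ hK9.le)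
  rw [hW]
  nlinarith only [hlogK, hd0, sq_nonneg δ, mul_nonneg hd0 hlogK, mul_nonneg (sq_nonneg δ) hlogK,
    sq_nonneg (X r 0), abs_nonneg (X r 3)]

end Summit.NavierStokesRegularity.FluidComputer.GateBudget
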